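import Summits.NavierStokesRegularity.NavierStokesRegularity.Theorems.FilamentSkeletonRssKelvinGateClosingPicard

/-!
# Route `FilamentSkeletonRss` · crux `TransverseReductionRJ` (stmt-NavierStokesRegularity-21221) — line `kelvin_gate`,
# stub S3 `NonlinearClosing`: the STATIC clauses of `AlmostAdmissibleJ` at the Picard fixed point

Helper file (theorems only, `--supports stmt-NavierStokesRegularity-21221 --as helper`), in the vocabulary of
`FilamentSkeletonRssKelvinGateDefs`.  HONEST FRAMING: bookkeeping for a HYPOTHETICAL filament-type RSS blow-up route;
nothing here bears on Navier–Stokes regularity; no stub is proved here.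

With the fixed-point forcing `F_p` of `…KelvinGateClosingPicard` (`Y(F_p) ≤ 2ε`, `ε = Cr Γ^(−k)`), the reduced family
`U_p = U⁰_p + 𝓚_p F_p`, `P_p = P⁰_p + 𝓠_p F_p`, `B_p = b⁰_p + 𝓑_p F_p` satisfies every clause of `AlmostAdmissibleJ` that
concerns ONE parameter `p`: the profile equation (file `…ClosingAlgebra`), `C²/C¹` regularity, incompressibility, the decay
`‖U_p y‖ ≤ C₀/(1+‖y‖)` with `C₀ = Cs Γ⁴ + R_W`, the pressure bound, non-degeneracy `U_p ≠ 0` (`‖U⁰_p y₀‖ ≥ 1 > R_W`) and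
the window closeness `η√Γ/2 + R_W ≤ η√Γ`, where `R_W = 2 C₂ Γ^κ ε` is the X-radius of the correction:

* `isDivFree_add` — incompressibility of a sum of differentiable fields;
* `GateSpec.static_at` — the per-parameter package above (given the smallness `16 (C₂Γ^κ)² ε ≤ 1`, `R_W ≤ 1/2`,
  `R_W ≤ η√Γ/2`);
* `rpow_gate_threshold` — the circulation thresholds: for `Γ ≥ 1` and `k ≥ 2κ + 1`, `(Γ^κ)² Γ^(−k) ≤ Γ⁻¹` and
  `Γ^κ Γ^(−k) ≤ Γ⁻¹`;
* `nonlinearClosing_static` — **stub S3 with its continuity clause factored out**: with the quantifier prefix of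
  `NonlinearClosing` VERBATIM (`k := ⌈2κ⌉₊ + 1`, `Γ₁` explicit), there are `C₀, M, U, P, B` such that
  `ContinuousOn B (cube) → AlmostAdmissibleJ N Γ ρ η Rw α X u D C₀ M U P B`, together with the structural identities
  `U_p = U⁰_p + 𝓚_p F_p`, `P_p = P⁰_p + 𝓠_p F_p`, `B_p = b⁰_p + 𝓑_p F_p` for a fixed-point forcing `F_p` with
  `Y(F_p) ≤ 2 Cr Γ^(−k)`.  The remaining conjunct `ContinuousOn B` is NOT derivable from `GateSpec` (3)/(4) as typed
  (sizing note «S3-SIZING-typer-g30.md», evidence on the item); it is exactly what a repaired gate clause must deliver.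
-/

set_option linter.dupNamespace false

noncomputable section

namespace Summit.NavierStokesRegularity.NavierStokesRegularity.Theorems.KelvinGate

open Set Function Filter
open Literature.Analysis.FluidPDE
open scoped InnerProductSpace Laplacian ContDiff Topology

/-- Incompressibility is additive on differentiable fields: `div (V + W) = div V + div W` pointwise. -/
theorem isDivFree_add {V W : EuclideanSpace ℝ (Fin 3) → EuclideanSpace ℝ (Fin 3)} (hV : VectorCalculus.IsDivFree V)
    (hW : VectorCalculus.IsDivFree W) (hVd : Differentiable ℝ V) (hWd : Differentiable ℝ W) :
    VectorCalculus.IsDivFree (fun y => V y + W y) := by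
  intro x
  have h1 := hV x
  have h2 := hW x
  unfold VectorCalculus.divergence at h1 h2 ⊢
  rw [fderiv_fun_add (hVd x) (hWd x)]
  push_cast
  rw [map_add, h1, h2, add_zero]

/-- **Per-parameter static package of stub S3.**  At a parameter `p` of the cube, let the base triple satisfy the
one-parameter clauses of `BaseSpec` (`U⁰_p ∈ C²` divergence-free and X-bounded by `S`, `P⁰_p ∈ C¹` bounded by `S`,
`‖U⁰_p y₀‖ ≥ 1`, window closeness `η√Γ/2`, residual `Y(r_p) ≤ ε`), let the gate satisfy `GateSpec`, and assume the
smallness `16 (C₂Γ^κ)² ε ≤ 1`, `R_W := C₂Γ^κ·(2ε) ≤ 1/2`, `R_W ≤ η√Γ/2`.  Then the Picard forcing `F` exists and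
`U = U⁰_p + 𝓚_p F`, `P = P⁰_p + 𝓠_p F`, `B = b⁰_p + 𝓑_p F` satisfy all one-parameter clauses of `AlmostAdmissibleJ`
with `C₀ = M = S + R_W`. -/
theorem GateSpec.static_at {N : ℕ} {Γ κ C₂ ρ η Rw : ℝ} {α : (Fin N → ℝ) → ℝ}
    {X : (Fin N → ℝ) → Fin N → ℝ → EuclideanSpace ℝ (Fin 3)}
    {u : (Fin N → ℝ) → (Fin N → ℝ → EuclideanSpace ℝ (Fin 3)) → EuclideanSpace ℝ (Fin 3) → EuclideanSpace ℝ (Fin 3)}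
    {D : (Fin N → ℝ) → Fin N → EuclideanSpace ℝ (Fin 3) → EuclideanSpace ℝ (Fin 3)}
    {U0 : (Fin N → ℝ) → EuclideanSpace ℝ (Fin 3) → EuclideanSpace ℝ (Fin 3)}
    {P0 : (Fin N → ℝ) → EuclideanSpace ℝ (Fin 3) → ℝ} {b0 : (Fin N → ℝ) → Fin N → ℝ}
    {𝓚 : (Fin N → ℝ) → (EuclideanSpace ℝ (Fin 3) → EuclideanSpace ℝ (Fin 3)) → EuclideanSpace ℝ (Fin 3) → EuclideanSpace ℝ (Fin 3)}
    {𝓠 : (Fin N → ℝ) → (EuclideanSpace ℝ (Fin 3) → EuclideanSpace ℝ (Fin 3)) → EuclideanSpace ℝ (Fin 3) → ℝ}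
    {𝓑 : (Fin N → ℝ) → (EuclideanSpace ℝ (Fin 3) → EuclideanSpace ℝ (Fin 3)) → Fin N → ℝ}
    (hgate : GateSpec N Γ κ C₂ α D U0 𝓚 𝓠 𝓑) {p : Fin N → ℝ} (hp : ∀ i, p i ∈ Icc (0:ℝ) 1)
    (hU0 : ContDiff ℝ 2 (U0 p)) (hP0 : ContDiff ℝ 1 (P0 p)) (hdiv0 : VectorCalculus.IsDivFree (U0 p))
    {S : ℝ} (hX0 : XBound (U0 p) S) (hP0b : ∀ y, |P0 p y| ≤ S) (hnd : ∃ y₀, 1 ≤ ‖U0 p y₀‖)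
    (hwin0 : ∀ y, ‖y‖ ≤ Rw * √Γ → (∀ j τ, ρ * √Γ / 4 ≤ ‖y - X p j τ‖) → ‖U0 p y - u p (X p) y‖ ≤ η * √Γ / 2)
    {ε : ℝ} (hr : YBound (baseRes α D U0 P0 b0 p) ε) (hA : 16 * (C₂ * Γ ^ κ) ^ 2 * ε ≤ 1)
    (hRW1 : C₂ * Γ ^ κ * (2 * ε) ≤ 1 / 2) (hRW2 : C₂ * Γ ^ κ * (2 * ε) ≤ η * √Γ / 2) :
    ∃ F : EuclideanSpace ℝ (Fin 3) → EuclideanSpace ℝ (Fin 3), YBound F (2 * ε) ∧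
      (∀ y, F y = -(baseRes α D U0 P0 b0 p y) - fderiv ℝ (𝓚 p F) y (𝓚 p F y)) ∧
      (fun z => U0 p z + 𝓚 p F z) ≠ 0 ∧ ContDiff ℝ 2 (fun z => U0 p z + 𝓚 p F z) ∧
      ContDiff ℝ 1 (fun z => P0 p z + 𝓠 p F z) ∧ VectorCalculus.IsDivFree (fun z => U0 p z + 𝓚 p F z) ∧
      (∀ y, α p • (cross (EuclideanSpace.single 2 1) ((fun z => U0 p z + 𝓚 p F z) y) -
            fderiv ℝ (fun z => U0 p z + 𝓚 p F z) y (cross (EuclideanSpace.single 2 1) y)) +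
          (1/2:ℝ) • (fun z => U0 p z + 𝓚 p F z) y + (1/2:ℝ) • fderiv ℝ (fun z => U0 p z + 𝓚 p F z) y y -
          (Laplacian.laplacian (fun z => U0 p z + 𝓚 p F z)) y +
          fderiv ℝ (fun z => U0 p z + 𝓚 p F z) y ((fun z => U0 p z + 𝓚 p F z) y) +
          gradient (fun z => P0 p z + 𝓠 p F z) y = ∑ j, (b0 p j + 𝓑 p F j) • D p j y) ∧
      (∀ y, ‖U0 p y + 𝓚 p F y‖ ≤ (S + C₂ * Γ ^ κ * (2 * ε)) / (1 + ‖y‖)) ∧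
      (∀ y, |P0 p y + 𝓠 p F y| ≤ S + C₂ * Γ ^ κ * (2 * ε)) ∧
      (∀ y, ‖y‖ ≤ Rw * √Γ → (∀ j τ, ρ * √Γ / 4 ≤ ‖y - X p j τ‖) →
          ‖(U0 p y + 𝓚 p F y) - u p (X p) y‖ ≤ η * √Γ) ∧
      (∀ j, |𝓑 p F j| ≤ C₂ * Γ ^ κ * (2 * ε)) := by
  obtain ⟨F, hF, hfix⟩ := hgate.exists_fixedPoint_forcing hp hr hA
  obtain ⟨hW, hQ1, hQb, hBb, hWdiv, -⟩ := (hgate p hp).1 F (2 * ε) hF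
  have hWd : Differentiable ℝ (𝓚 p F) := hW.1.differentiable (by norm_num)
  have hU0d : Differentiable ℝ (U0 p) := hU0.differentiable (by norm_num)
  have hWpt : ∀ y, ‖𝓚 p F y‖ ≤ C₂ * Γ ^ κ * (2 * ε) := fun y => (hW.norm_le' y).1
  refine ⟨F, hF, hfix, ?_, hU0.add hW.1, hP0.add hQ1, isDivFree_add hdiv0 hWdiv hU0d hWd,
    hgate.profileEquation_of_fixedPoint hp hU0 (hP0.differentiable (by norm_num)) hF hfix, ?_, ?_, ?_, hBb⟩
  · -- non-degeneracy: `‖U⁰_p y₀‖ ≥ 1 > 1/2 ≥ ‖W y₀‖`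
    obtain ⟨y₀, hy₀⟩ := hnd
    intro hzero
    have h0 : U0 p y₀ + 𝓚 p F y₀ = 0 := by
      have := congrFun hzero y₀
      simpa using this
    have h1 : ‖U0 p y₀‖ = ‖𝓚 p F y₀‖ := by
      rw [show U0 p y₀ = -(𝓚 p F y₀) from eq_neg_of_add_eq_zero_left h0, norm_neg]
    linarith [hWpt y₀]
  · -- decay
    intro y
    rw [_root_.add_div]
    exact (norm_add_le _ _).trans (add_le_add (hX0.norm_le y) (hW.norm_le y))
  · -- pressure bound
    intro y
    exact (abs_add_le _ _).trans (add_le_add (hP0b y) (hQb y))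
  · -- window closeness
    intro y hy htube
    calc ‖(U0 p y + 𝓚 p F y) - u p (X p) y‖ = ‖(U0 p y - u p (X p) y) + 𝓚 p F y‖ := by abel_nf
      _ ≤ ‖U0 p y - u p (X p) y‖ + ‖𝓚 p F y‖ := norm_add_le _ _
      _ ≤ η * √Γ / 2 + η * √Γ / 2 := add_le_add (hwin0 y hy htube) ((hWpt y).trans hRW2)
      _ = η * √Γ := by ring

/-- **Circulation thresholds.**  For `Γ ≥ 1` and a natural order `k ≥ 2κ + 1`:
`(Γ^κ)² · Γ^(−k) ≤ Γ⁻¹` and `Γ^κ · Γ^(−k) ≤ Γ⁻¹` (real powers). -/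
theorem rpow_gate_threshold {Γ κ : ℝ} {k : ℕ} (hΓ : 1 ≤ Γ) (hk : 2 * κ + 1 ≤ k) (hk1 : 1 ≤ k) :
    (Γ ^ κ) ^ 2 * Γ ^ (-(k:ℝ)) ≤ Γ⁻¹ ∧ Γ ^ κ * Γ ^ (-(k:ℝ)) ≤ Γ⁻¹ := by
  have hΓ0 : 0 < Γ := by linarith
  have e1 : (Γ ^ κ) ^ 2 * Γ ^ (-(k:ℝ)) = Γ ^ (2 * κ - k) := by
    rw [← Real.rpow_natCast (Γ ^ κ) 2, ← Real.rpow_mul hΓ0.le, ← Real.rpow_add hΓ0]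
    congr 1; push_cast; ring
  have e2 : Γ ^ κ * Γ ^ (-(k:ℝ)) = Γ ^ (κ - k) := by
    rw [sub_eq_add_neg, Real.rpow_add hΓ0]
  have e3 : Γ⁻¹ = Γ ^ (-(1:ℝ)) := by rw [Real.rpow_neg hΓ0.le, Real.rpow_one]
  rw [e1, e2, e3]
  have hk' : (1:ℝ) ≤ k := by exact_mod_cast hk1
  constructor
  · exact Real.rpow_le_rpow_of_exponent_le hΓ (by linarith)
  · refine Real.rpow_le_rpow_of_exponent_le hΓ ?_
    -- `κ − k ≤ −1`: if `κ ≥ 0` use `k ≥ 2κ+1 ≥ κ+1`; if `κ < 0` use `k ≥ 1`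
    rcases le_or_gt 0 κ with hκ | hκ
    · linarith
    · linarith

/-- **Stub S3 `NonlinearClosing` with its continuity clause factored out.**  With the quantifier prefix of
`NonlinearClosing` VERBATIM — given the box constants and `Cs, κ, C₂`, take the dressing order `k := ⌈2κ⌉₊ + 1` and, given
`Cr`, the threshold `Γ₁ := max 1 (16 C₂²|Cr| + 4|C₂||Cr| + 4|C₂||Cr|/η + 1)` — for every `Γ ≥ Γ₁`, all data, every base
family (`BaseSpec`) and every gate (`GateSpec`) there are `C₀, M, U, P, B` such that
(i) `ContinuousOn B (cube) → AlmostAdmissibleJ N Γ ρ η Rw α X u D C₀ M U P B`, and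
(ii) structurally `U_p = U⁰_p + 𝓚_p F_p`, `P_p = P⁰_p + 𝓠_p F_p`, `B_p = b⁰_p + 𝓑_p F_p` on the cube, for a forcing `F_p`
with `Y(F_p) ≤ 2 Cr Γ^(−k)` solving the fixed-point relation `F_p = −r_p − D(𝓚_p F_p)[𝓚_p F_p]`.
So S3 is reduced to ONE statement: continuity on the cube of `p ↦ b⁰_p + 𝓑_p F_p` (see the sizing note on the item for why
`GateSpec` (3)/(4) as typed do not give it, and the proposed joint-continuity clause that does). -/
theorem nonlinearClosing_static :
    ∀ (N : ℕ) (δ ρ K Λ a b cnd η Rw Rb cg θ₀ : ℝ), 0 < N → 0 < δ → 0 < ρ → 0 ≤ a → 0 < η → 0 < Rw → 0 < Rb →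
      0 < cg → 0 < θ₀ →
    ∀ Cs κ C₂ : ℝ, ∃ k : ℕ, 1 ≤ k ∧ ∀ Cr : ℝ, ∃ Γ₁ : ℝ, ∀ Γ : ℝ, Γ₁ ≤ Γ →
      ∀ (γ : (Fin N → ℝ) → Fin N → ℝ) (α : (Fin N → ℝ) → ℝ) (X : (Fin N → ℝ) → Fin N → ℝ → EuclideanSpace ℝ (Fin 3))
        (w : (Fin N → ℝ) → Fin N → ℝ → ℝ) (c : (Fin N → ℝ) → Fin N → ℝ) (m : (Fin N → ℝ) → Fin N → EuclideanSpace ℝ (Fin 3))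
        (n : (Fin N → ℝ) → Fin N → EuclideanSpace ℝ (Fin 3))
        (u : (Fin N → ℝ) → (Fin N → ℝ → EuclideanSpace ℝ (Fin 3)) → EuclideanSpace ℝ (Fin 3) → EuclideanSpace ℝ (Fin 3))
        (v : (Fin N → ℝ) → EuclideanSpace ℝ (Fin 3) → EuclideanSpace ℝ (Fin 3))
        (A : (Fin N → ℝ) → Fin N → (EuclideanSpace ℝ (Fin 3) →L[ℝ] EuclideanSpace ℝ (Fin 3)))
        (T : (Fin N → ℝ) → (Fin N → ℝ → EuclideanSpace ℝ (Fin 3)) → Fin N → ℝ → EuclideanSpace ℝ (Fin 3))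
        (D : (Fin N → ℝ) → Fin N → EuclideanSpace ℝ (Fin 3) → EuclideanSpace ℝ (Fin 3)),
      DefU N Γ γ u → DefV N α X u v → DefA N X c v A → DefT N α u T → DefD N X c D →
      BoxClausesJ N Γ δ ρ K Λ a b cnd Rw Rb cg θ₀ γ α X w c m n v A T →
      ∀ (U0 : (Fin N → ℝ) → EuclideanSpace ℝ (Fin 3) → EuclideanSpace ℝ (Fin 3)) (P0 : (Fin N → ℝ) → EuclideanSpace ℝ (Fin 3) → ℝ)
        (b0 : (Fin N → ℝ) → Fin N → ℝ), BaseSpec N Γ ρ η Rw k Cs Cr α X u D U0 P0 b0 →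
      ∀ (𝓚 : (Fin N → ℝ) → (EuclideanSpace ℝ (Fin 3) → EuclideanSpace ℝ (Fin 3)) → EuclideanSpace ℝ (Fin 3) → EuclideanSpace ℝ (Fin 3))
        (𝓠 : (Fin N → ℝ) → (EuclideanSpace ℝ (Fin 3) → EuclideanSpace ℝ (Fin 3)) → EuclideanSpace ℝ (Fin 3) → ℝ)
        (𝓑 : (Fin N → ℝ) → (EuclideanSpace ℝ (Fin 3) → EuclideanSpace ℝ (Fin 3)) → Fin N → ℝ),
        GateSpec N Γ κ C₂ α D U0 𝓚 𝓠 𝓑 →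
      ∃ (C₀ M : ℝ) (U : (Fin N → ℝ) → EuclideanSpace ℝ (Fin 3) → EuclideanSpace ℝ (Fin 3))
        (P : (Fin N → ℝ) → EuclideanSpace ℝ (Fin 3) → ℝ) (B : (Fin N → ℝ) → Fin N → ℝ),
        (ContinuousOn B {p : Fin N → ℝ | ∀ i, p i ∈ Icc 0 1} → AlmostAdmissibleJ N Γ ρ η Rw α X u D C₀ M U P B) ∧
        ∀ p : Fin N → ℝ, (∀ i, p i ∈ Icc 0 1) →
          ∃ F : EuclideanSpace ℝ (Fin 3) → EuclideanSpace ℝ (Fin 3), YBound F (2 * (Cr * Γ ^ (-(k:ℝ)))) ∧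
            (∀ y, F y = -(baseRes α D U0 P0 b0 p y) - fderiv ℝ (𝓚 p F) y (𝓚 p F y)) ∧
            U p = (fun z => U0 p z + 𝓚 p F z) ∧ P p = (fun z => P0 p z + 𝓠 p F z) ∧
            B p = (fun j => b0 p j + 𝓑 p F j) := by
  intro N δ ρ K Λ a b cnd η Rw Rb cg θ₀ hN hδ hρ ha hη hRw hRb hcg hθ₀ Cs κ C₂
  refine ⟨⌈2 * κ⌉₊ + 1, Nat.le_add_left 1 _, fun Cr => ?_⟩
  have hk1 : 1 ≤ ⌈2 * κ⌉₊ + 1 := Nat.le_add_left 1 _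
  have hk : 2 * κ + 1 ≤ ((⌈2 * κ⌉₊ + 1 : ℕ) : ℝ) := by
    have h := Nat.le_ceil (2 * κ)
    push_cast
    linarith
  refine ⟨max 1 (16 * C₂ ^ 2 * |Cr| + 4 * |C₂| * |Cr| + 4 * |C₂| * |Cr| / η + 1), fun Γ hΓ => ?_⟩
  intro γ α X w c m n u v A T D hu hv hA hT hD hbox U0 P0 b0 hbase 𝓚 𝓠 𝓑 hgate
  have hΓ1 : 1 ≤ Γ := le_trans (le_max_left _ _) hΓ
  have hΓ0 : 0 < Γ := by linarith
  have hΓ2 : 16 * C₂ ^ 2 * |Cr| + 4 * |C₂| * |Cr| + 4 * |C₂| * |Cr| / η + 1 ≤ Γ := le_trans (le_max_right _ _) hΓ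
  obtain ⟨ht1, ht2⟩ := rpow_gate_threshold hΓ1 hk hk1
  -- the residual constant is non-negative (the cube is inhabited)
  have hp0 : ∀ i : Fin N, (fun _ : Fin N => (0:ℝ)) i ∈ Icc (0:ℝ) 1 := fun _ => ⟨le_rfl, zero_le_one⟩
  have hε0 : 0 ≤ Cr * Γ ^ (-(((⌈2 * κ⌉₊ + 1 : ℕ)) : ℝ)) := (hbase.2 _ hp0).2.2.2.2.2.2.2.2.1.nonneg
  have hpow : 0 < Γ ^ (-(((⌈2 * κ⌉₊ + 1 : ℕ)) : ℝ)) := Real.rpow_pos_of_pos hΓ0 _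
  have hCr : 0 ≤ Cr := by
    by_contra hlt
    push Not at hlt
    have : Cr * Γ ^ (-(((⌈2 * κ⌉₊ + 1 : ℕ)) : ℝ)) < 0 := mul_neg_of_neg_of_pos hlt hpow
    linarith
  have hCr' : Cr = |Cr| := (abs_of_nonneg hCr).symm
  have hκ0 : 0 ≤ Γ ^ κ := Real.rpow_nonneg hΓ0.le κ
  have habs : |C₂| * |Cr| * 4 ≤ Γ := by
    have h1 : 0 ≤ 16 * C₂ ^ 2 * |Cr| := by positivity
    have h2 : 0 ≤ 4 * |C₂| * |Cr| / η := by positivity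
    linarith
  -- smallness 1: `16 (C₂Γ^κ)² ε ≤ 1`
  have hA' : 16 * (C₂ * Γ ^ κ) ^ 2 * (Cr * Γ ^ (-(((⌈2 * κ⌉₊ + 1 : ℕ)) : ℝ))) ≤ 1 := by
    have e : 16 * (C₂ * Γ ^ κ) ^ 2 * (Cr * Γ ^ (-(((⌈2 * κ⌉₊ + 1 : ℕ)) : ℝ))) =
        16 * C₂ ^ 2 * Cr * ((Γ ^ κ) ^ 2 * Γ ^ (-(((⌈2 * κ⌉₊ + 1 : ℕ)) : ℝ))) := by ring
    rw [e]
    have h1 : 16 * C₂ ^ 2 * Cr * ((Γ ^ κ) ^ 2 * Γ ^ (-(((⌈2 * κ⌉₊ + 1 : ℕ)) : ℝ))) ≤ 16 * C₂ ^ 2 * Cr * Γ⁻¹ :=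
      mul_le_mul_of_nonneg_left ht1 (by positivity)
    have h2 : 16 * C₂ ^ 2 * Cr * Γ⁻¹ ≤ 1 := by
      rw [← div_eq_mul_inv, div_le_one hΓ0, hCr']
      have : 0 ≤ 4 * |C₂| * |Cr| / η := by positivity
      have : 0 ≤ 4 * |C₂| * |Cr| := by positivity
      linarith
    exact h1.trans h2
  -- smallness 2 and 3: `R_W ≤ 1/2`, `R_W ≤ η√Γ/2`
  have hRW : C₂ * Γ ^ κ * (2 * (Cr * Γ ^ (-(((⌈2 * κ⌉₊ + 1 : ℕ)) : ℝ)))) ≤ 2 * |C₂| * |Cr| * Γ⁻¹ := by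
    have e : C₂ * Γ ^ κ * (2 * (Cr * Γ ^ (-(((⌈2 * κ⌉₊ + 1 : ℕ)) : ℝ)))) =
        2 * (C₂ * Cr) * (Γ ^ κ * Γ ^ (-(((⌈2 * κ⌉₊ + 1 : ℕ)) : ℝ))) := by ring
    rw [e]
    have h1 : 2 * (C₂ * Cr) * (Γ ^ κ * Γ ^ (-(((⌈2 * κ⌉₊ + 1 : ℕ)) : ℝ))) ≤
        2 * (|C₂| * |Cr|) * (Γ ^ κ * Γ ^ (-(((⌈2 * κ⌉₊ + 1 : ℕ)) : ℝ))) := by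
      refine mul_le_mul_of_nonneg_right (mul_le_mul_of_nonneg_left ?_ (by norm_num)) (mul_nonneg hκ0 hpow.le)
      rw [← abs_mul]; exact le_abs_self _
    have h2 : 2 * (|C₂| * |Cr|) * (Γ ^ κ * Γ ^ (-(((⌈2 * κ⌉₊ + 1 : ℕ)) : ℝ))) ≤ 2 * (|C₂| * |Cr|) * Γ⁻¹ :=
      mul_le_mul_of_nonneg_left ht2 (by positivity)
    linarith
  have hinv : 2 * |C₂| * |Cr| * Γ⁻¹ ≤ 1 / 2 := by
    rw [← div_eq_mul_inv, div_le_iff₀ hΓ0]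
    linarith
  have hRW1 : C₂ * Γ ^ κ * (2 * (Cr * Γ ^ (-(((⌈2 * κ⌉₊ + 1 : ℕ)) : ℝ)))) ≤ 1 / 2 := hRW.trans hinv
  have hRW2 : C₂ * Γ ^ κ * (2 * (Cr * Γ ^ (-(((⌈2 * κ⌉₊ + 1 : ℕ)) : ℝ)))) ≤ η * √Γ / 2 := by
    refine hRW.trans ?_
    have hs : 1 ≤ √Γ := by rw [← Real.sqrt_one]; exact Real.sqrt_le_sqrt hΓ1
    have h1 : 2 * |C₂| * |Cr| * Γ⁻¹ ≤ η / 2 := by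
      rw [← div_eq_mul_inv, div_le_iff₀ hΓ0]
      have h3 : 4 * |C₂| * |Cr| / η ≤ Γ := by
        have : 0 ≤ 16 * C₂ ^ 2 * |Cr| := by positivity
        have : 0 ≤ 4 * |C₂| * |Cr| := by positivity
        linarith
      have h4 := (div_le_iff₀ hη).mp h3
      linarith
    have h2 : η / 2 ≤ η * √Γ / 2 := by
      have := mul_le_mul_of_nonneg_left hs hη.le
      linarith
    exact h1.trans h2
  -- per-parameter package
  have key : ∀ p : Fin N → ℝ, (∀ i, p i ∈ Icc (0:ℝ) 1) → ∃ F : EuclideanSpace ℝ (Fin 3) → EuclideanSpace ℝ (Fin 3),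
      YBound F (2 * (Cr * Γ ^ (-(((⌈2 * κ⌉₊ + 1 : ℕ)) : ℝ)))) ∧
      (∀ y, F y = -(baseRes α D U0 P0 b0 p y) - fderiv ℝ (𝓚 p F) y (𝓚 p F y)) ∧
      (fun z => U0 p z + 𝓚 p F z) ≠ 0 ∧ ContDiff ℝ 2 (fun z => U0 p z + 𝓚 p F z) ∧
      ContDiff ℝ 1 (fun z => P0 p z + 𝓠 p F z) ∧ VectorCalculus.IsDivFree (fun z => U0 p z + 𝓚 p F z) ∧
      (∀ y, α p • (cross (EuclideanSpace.single 2 1) ((fun z => U0 p z + 𝓚 p F z) y) -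
            fderiv ℝ (fun z => U0 p z + 𝓚 p F z) y (cross (EuclideanSpace.single 2 1) y)) +
          (1/2:ℝ) • (fun z => U0 p z + 𝓚 p F z) y + (1/2:ℝ) • fderiv ℝ (fun z => U0 p z + 𝓚 p F z) y y -
          (Laplacian.laplacian (fun z => U0 p z + 𝓚 p F z)) y +
          fderiv ℝ (fun z => U0 p z + 𝓚 p F z) y ((fun z => U0 p z + 𝓚 p F z) y) +
          gradient (fun z => P0 p z + 𝓠 p F z) y = ∑ j, (b0 p j + 𝓑 p F j) • D p j y) ∧
      (∀ y, ‖U0 p y + 𝓚 p F y‖ ≤ (Cs * Γ ^ 4 + C₂ * Γ ^ κ * (2 * (Cr * Γ ^ (-(((⌈2 * κ⌉₊ + 1 : ℕ)) : ℝ))))) / (1 + ‖y‖)) ∧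
      (∀ y, |P0 p y + 𝓠 p F y| ≤ Cs * Γ ^ 4 + C₂ * Γ ^ κ * (2 * (Cr * Γ ^ (-(((⌈2 * κ⌉₊ + 1 : ℕ)) : ℝ))))) ∧
      (∀ y, ‖y‖ ≤ Rw * √Γ → (∀ j τ, ρ * √Γ / 4 ≤ ‖y - X p j τ‖) →
          ‖(U0 p y + 𝓚 p F y) - u p (X p) y‖ ≤ η * √Γ) ∧
      (∀ j, |𝓑 p F j| ≤ C₂ * Γ ^ κ * (2 * (Cr * Γ ^ (-(((⌈2 * κ⌉₊ + 1 : ℕ)) : ℝ))))) := by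
    intro p hp
    obtain ⟨hU0s, hP0s, hdiv0, hX0, hP0b, -, hnd, hwin0, hres, -⟩ := hbase.2 p hp
    exact hgate.static_at hp (contDiff_infty.mp hU0s 2) (contDiff_infty.mp hP0s 1)
      hdiv0 hX0 hP0b hnd hwin0 hres hA' hRW1 hRW2
  choose! F hF using key
  refine ⟨Cs * Γ ^ 4 + C₂ * Γ ^ κ * (2 * (Cr * Γ ^ (-(((⌈2 * κ⌉₊ + 1 : ℕ)) : ℝ)))),
    Cs * Γ ^ 4 + C₂ * Γ ^ κ * (2 * (Cr * Γ ^ (-(((⌈2 * κ⌉₊ + 1 : ℕ)) : ℝ)))),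
    fun p z => U0 p z + 𝓚 p (F p) z, fun p z => P0 p z + 𝓠 p (F p) z, fun p j => b0 p j + 𝓑 p (F p) j, ?_, ?_⟩
  · intro hcontB
    refine ⟨hcontB, fun p hp => ?_⟩
    obtain ⟨-, -, hne, hC2, hC1, hdiv, heq, hdec, hPb, hwin, -⟩ := hF p hp
    exact ⟨hne, hC2, hC1, hdiv, heq, hdec, hPb, hwin⟩
  · intro p hp
    exact ⟨F p, (hF p hp).1, (hF p hp).2.1, rfl, rfl, rfl⟩

end Summit.NavierStokesRegularity.NavierStokesRegularity.Theorems.KelvinGate
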